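import Summits.CriticalPhenomena.PercolationContinuityZ3.Theorems.Transplant.PlanarSkeletonFrmFromDefs
import Summits.CriticalPhenomena.PercolationContinuityZ3.Theorems.Transplant.SkelFrmFromBChoiceWindowY2
import Summits.CriticalPhenomena.PercolationContinuityZ3.Theorems.Transplant.SkelFrmBChoiceWindowY2
import Summits.CriticalPhenomena.PercolationContinuityZ3.Theorems.Transplant.SkelFrmFromBParamsCorrKGLen3
import Summits.CriticalPhenomena.PercolationContinuityZ3.Theorems.Transplant.SkelFrmBParamsCorrKGLen3
import HarnessLib
import Summits.CriticalPhenomena.PercolationContinuityZ3.Theorems.Transplant.SkelFrmBChoiceWindow3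
/-!
# U-WAVE PORT (RULING D-U, lead g21 2026-08-26; WAVE-U-MANIFEST v3.0 row «SkelFrmBChoiceWindow3» ↦ «SkelFrmFromBChoiceWindow3») of the tree module
# `Transplant/SkelFrmBChoiceWindow3` onto the carrier `PlanarSkeletonFrmFrom` (frames only, cylinders connected from width `ℓ₀` on)

ORIGINAL TITLE: N2 (frames-only node `SamePDropOfSkeletonFrm₁`, OPEN) — (ζ″) ledger under J23/(R-44): THE WIDER WINDOW SLOT OF RECORD **`BSlot.small3 := (76·s₀, 19·s₁)`**

builds on p205010 (kernel theorem, internal audit signed; external expert review pending) — nothing in this file uses p205010; NOTHING is claimed about the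
OPEN node U `SamePDropOfSkeletonFrmFrom₁` (nor U_s / the end state).  Lane `prim-bschramm`, seat `prim-hp-8 gen 53 (U-wave port pen, family P-hp8; tool of record = p3-g26 port_u.py)`; helper file
(`--supports stmt-CriticalPhenomena-4575 --as helper`).  PORT RULES r1–r4 of RULING D-U: declaration order and proof texts are those of the original,
byte-identical except (i) the carrier token `PlanarSkeletonFrm ↦ PlanarSkeletonFrmFrom` (binders, `namespace`/`end` lines, qualified names of twinned
declarations), (ii) carrier-FREE declarations of the original (φ-level `Skelφ…` blocks and namespace-only arithmetic residents) are NOT re-declared —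
this file imports the original and `export`s the twin-free residents (POLICY T / treatment (m1)); residents whose statement mentions a twinned
constant are copied, (iii) every carrier-binding declaration keeps its explicit binder `(Φ : PlanarSkeletonFrmFrom G)` in its own signature (r2).  Docstrings and citations are the original's.  Manifest row idx 85 (level 12; flags verbatim|DEF-ROW); filed by the hp-8 lineage under RULING M-11 (family P-hp8).
-/

open scoped Classical

noncomputable section

namespace Summit.CriticalPhenomena.PercolationContinuityZ3.Theorems.Transplant

namespace PlanarSkeletonFrmFrom

namespace NegB

open Literature.Probability.Percolation Literature.Probability.LatticeModels SimpleGraph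
open SkelConc (Consts)
open Skelφ (shearUnit kgSL kgSLY)
open Neg

/-! ## §1 The wider window slot -/

/-- **THE WINDOW SLOT OF RECORD under J23/(R-44)**: `b := (76·s₀, 19·s₁)` (fine units). [this work] -/
def BSlot.small3 : BSlot := fun κ _ _ _ _ _ Φ t p D g f i => (if i = 0 then 76 else 19) * (fcellsA κ Φ t p D g f).s i

section Small2

variable (κ : Consts) {V : Type} [DecidableEq V] [Countable V] {G : SimpleGraph V} [G.LocallyFinite] (Φ : PlanarSkeletonFrmFrom G) (t : V) (p : unitInterval)
  (D : Skelφ.StepI.DataNS V) (g f : ℕ)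

/-- `small3 = (76·s₀, 19·s₁)` by `rfl`. [folklore] -/
theorem small3_eq (κ : Consts) {V : Type} [DecidableEq V] [Countable V] {G : SimpleGraph V} [G.LocallyFinite] (Φ : PlanarSkeletonFrmFrom G) (t : V) (p : unitInterval) (D : Skelφ.StepI.DataNS V) (g : ℕ) (f : ℕ) : BSlot.small3 κ Φ t p D g f 0 = 76 * (fcellsA κ Φ t p D g f).s 0 ∧ BSlot.small3 κ Φ t p D g f 1 = 19 * (fcellsA κ Φ t p D g f).s 1 :=
  ⟨rfl, rfl⟩

/-- `s i ≤ small3 i ≤ 76·s i`. [folklore] -/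
theorem small3_bounds (κ : Consts) {V : Type} [DecidableEq V] [Countable V] {G : SimpleGraph V} [G.LocallyFinite] (Φ : PlanarSkeletonFrmFrom G) (t : V) (p : unitInterval) (D : Skelφ.StepI.DataNS V) (g : ℕ) (f : ℕ) (i : Fin 2) : BSlot.small3 κ Φ t p D g f i ≤ 76 * (fcellsA κ Φ t p D g f).s i ∧ (fcellsA κ Φ t p D g f).s i ≤ BSlot.small3 κ Φ t p D g f i := by
  have hs := (fcellsA κ Φ t p D g f).hs i
  simp only [BSlot.small3]
  split_ifs <;> omega

/-- `1 ≤ small3 i`. [folklore] -/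
theorem small3_pos (κ : Consts) {V : Type} [DecidableEq V] [Countable V] {G : SimpleGraph V} [G.LocallyFinite] (Φ : PlanarSkeletonFrmFrom G) (t : V) (p : unitInterval) (D : Skelφ.StepI.DataNS V) (g : ℕ) (f : ℕ) (i : Fin 2) : 1 ≤ BSlot.small3 κ Φ t p D g f i := by
  have := (fcellsA κ Φ t p D g f).hs i; have := (small3_bounds κ Φ t p D g f i).2; omega

/-- `small3 i ≤ 3·r i` (`r = K·s`, `K ≥ 40`), so `bS … small3 = small3` (`bS_eq`). [folklore] -/
theorem small3_le (κ : Consts) {V : Type} [DecidableEq V] [Countable V] {G : SimpleGraph V} [G.LocallyFinite] (Φ : PlanarSkeletonFrmFrom G) (t : V) (p : unitInterval) (D : Skelφ.StepI.DataNS V) (g : ℕ) (f : ℕ) (i : Fin 2) : BSlot.small3 κ Φ t p D g f i ≤ 3 * (fcellsA κ Φ t p D g f).r i := by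
  refine (small3_bounds κ Φ t p D g f i).1.trans ?_
  have hr : (((fcellsA κ Φ t p D g f).r i : ℕ) : ℤ) = (fcellsA κ Φ t p D g f).K * (fcellsA κ Φ t p D g f).s i := PCells2.r_eq _ i
  have hK : 40 ≤ (fcellsA κ Φ t p D g f).K := by rw [(fcellsA_K κ Φ t p D g f).1]; exact (Skelφ.NegPrm.forty_le_Kcell κ.K₀).1
  have : ((76 * (fcellsA κ Φ t p D g f).s i : ℕ) : ℤ) ≤ ((3 * (fcellsA κ Φ t p D g f).r i : ℕ) : ℤ) := by
    push_cast; rw [hr]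
    have hK' : (40 : ℤ) ≤ (fcellsA κ Φ t p D g f).K := by exact_mod_cast hK
    have hs : (0 : ℤ) ≤ (fcellsA κ Φ t p D g f).s i := by positivity
    nlinarith
  exact_mod_cast this

/-- The wider window meets the smallness rows with `(e₀, e₁) = (77, 20)`: `76s₀ + 1 ≤ 77·s₀`, `|v_L|·(19s₁ + 1) ≤ 20·n_L·s₁`. [folklore] -/
theorem small3_rows (κ : Consts) {V : Type} [DecidableEq V] [Countable V] {G : SimpleGraph V} [G.LocallyFinite] (Φ : PlanarSkeletonFrmFrom G) (t : V) (p : unitInterval) (D : Skelφ.StepI.DataNS V) (g : ℕ) (f : ℕ) (hN : EqNumL κ Φ t p D g f) :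
    ((BSlot.small3 κ Φ t p D g f 0 : ℕ) : ℤ) + 1 ≤ 77 * (((fcellsA κ Φ t p D g f).s 0 : ℕ) : ℤ) ∧
    |vL κ Φ t p D g f| * (((BSlot.small3 κ Φ t p D g f 1 : ℕ) : ℤ) + 1) ≤ 20 * (nL κ Φ t p D g f : ℤ) * (((fcellsA κ Φ t p D g f).s 1 : ℕ) : ℤ) := by
  have hs0 := (fcellsA κ Φ t p D g f).hs 0
  have hs1 : (1 : ℤ) ≤ (((fcellsA κ Φ t p D g f).s 1 : ℕ) : ℤ) := by exact_mod_cast (fcellsA κ Φ t p D g f).hs 1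
  have hv := hN.v_le
  have hva : (0 : ℤ) ≤ |vL κ Φ t p D g f| := abs_nonneg _
  rw [(small3_eq κ Φ t p D g f).1, (small3_eq κ Φ t p D g f).2]
  push_cast
  constructor
  · have : (1 : ℤ) ≤ (((fcellsA κ Φ t p D g f).s 0 : ℕ) : ℤ) := by exact_mod_cast hs0
    linarith
  · nlinarith

/-- **`aWS small3 ≤ 98·n_L`.** [this work] -/
theorem aWS_small3_le (κ : Consts) {V : Type} [DecidableEq V] [Countable V] {G : SimpleGraph V} [G.LocallyFinite] (Φ : PlanarSkeletonFrmFrom G) (t : V) (p : unitInterval) (D : Skelφ.StepI.DataNS V) (g : ℕ) (f : ℕ) (hN : EqNumL κ Φ t p D g f) : aWS κ Φ t p D g f (BSlot.small3 κ Φ t p D g f) ≤ 98 * (nL κ Φ t p D g f : ℤ) := by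
  obtain ⟨h0, h1⟩ := small3_rows κ Φ t p D g f hN
  have h := aWS_le_of κ Φ t p D g f _ hN h0 h1
  norm_num at h; linarith

/-- `small3 1 + 1 ≤ 20·s₁` (the `e = 20` row of `bLS_le`). [folklore] -/
theorem small3_row_across (κ : Consts) {V : Type} [DecidableEq V] [Countable V] {G : SimpleGraph V} [G.LocallyFinite] (Φ : PlanarSkeletonFrmFrom G) (t : V) (p : unitInterval) (D : Skelφ.StepI.DataNS V) (g : ℕ) (f : ℕ) : ((BSlot.small3 κ Φ t p D g f 1 : ℕ) : ℤ) + 1 ≤ 20 * (((fcellsA κ Φ t p D g f).s 1 : ℕ) : ℤ) := by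
  have hs1 : (1 : ℤ) ≤ (((fcellsA κ Φ t p D g f).s 1 : ℕ) : ℤ) := by exact_mod_cast (fcellsA κ Φ t p D g f).hs 1
  rw [(small3_eq κ Φ t p D g f).2]; push_cast; linarith

end Small2

/-! ## §2 The wider residual windows and the start-box rows -/

section Residuals2

variable (κ : Consts) {V : Type} [DecidableEq V] [Countable V] {G : SimpleGraph V} [G.LocallyFinite] (Φ : PlanarSkeletonFrmFrom G) (t : V) (p : unitInterval)
  (D : Skelφ.StepI.DataNS V) (g f : ℕ)

/-- **The x-corridor's along residual at `small3`**: `qxQ4 := 96·n_L` (`kgq qxQ4 = 98·n_L ≥ aWS small3`). [this work] -/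
def qxQ4 (κ : Consts) {V : Type} [DecidableEq V] [Countable V] {G : SimpleGraph V} [G.LocallyFinite] (Φ : PlanarSkeletonFrmFrom G) (t : V) (p : unitInterval) (D : Skelφ.StepI.DataNS V) (g : ℕ) (f : ℕ) : ℕ := 96 * nL κ Φ t p D g f

/-- **The x-corridor's across residual at `small3`**: `WxQ4 := (19·sL)₊ + 42` (`P + kgW WxQ4 ≥ 20·sL + 42 ≥ bLS small3`). [this work] -/
def WxQ4 (κ : Consts) {V : Type} [DecidableEq V] [Countable V] {G : SimpleGraph V} [G.LocallyFinite] (Φ : PlanarSkeletonFrmFrom G) (t : V) (p : unitInterval) (D : Skelφ.StepI.DataNS V) (g : ℕ) (f : ℕ) : ℕ := (19 * kgSL (nL κ Φ t p D g f) (ℓL κ Φ t p D g f) (hL κ Φ t p D g f)).toNat + 42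

/-- **The y′-corridor's along residual at `small3`**: `qxYQ4 := (19·sL)₊ + 42` (`kgqY qxYQ4 = P + 19·sL + 42 ≥ bLS small3`). [this work] -/
def qxYQ4 (κ : Consts) {V : Type} [DecidableEq V] [Countable V] {G : SimpleGraph V} [G.LocallyFinite] (Φ : PlanarSkeletonFrmFrom G) (t : V) (p : unitInterval) (D : Skelφ.StepI.DataNS V) (g : ℕ) (f : ℕ) : ℕ := (19 * kgSL (nL κ Φ t p D g f) (ℓL κ Φ t p D g f) (hL κ Φ t p D g f)).toNat + 42

/-- **The y′-corridor's across residual at `small3`**: `WxYQ4 := 96·n_L` (`kgWY WxYQ4 = 98·n_L ≥ aWS small3`). [this work] -/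
def WxYQ4 (κ : Consts) {V : Type} [DecidableEq V] [Countable V] {G : SimpleGraph V} [G.LocallyFinite] (Φ : PlanarSkeletonFrmFrom G) (t : V) (p : unitInterval) (D : Skelφ.StepI.DataNS V) (g : ℕ) (f : ℕ) : ℕ := 96 * nL κ Φ t p D g f

/-- **`KGRes3 … qxQ4 WxQ4`** (`96n ≤ 100n`, `19sL + 42 ≤ 20·sL`). [this work] -/
theorem kgRes3_Q4 (κ : Consts) {V : Type} [DecidableEq V] [Countable V] {G : SimpleGraph V} [G.LocallyFinite] (Φ : PlanarSkeletonFrmFrom G) (t : V) (p : unitInterval) (D : Skelφ.StepI.DataNS V) (g : ℕ) (f : ℕ) (hN : EqNumL κ Φ t p D g f) : KGRes3 κ Φ t p D g f (qxQ4 κ Φ t p D g f) (WxQ4 κ Φ t p D g f) := by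
  refine ⟨by unfold qxQ4; omega, ?_⟩
  have hsL := ML_sub_one_le_kgSL κ Φ t p D g f hN
  have h960 := slack_floor_le_ML κ Φ t p D g
  have hM : (959 : ℤ) ≤ ML κ Φ t p D g := by exact_mod_cast (show 959 ≤ ML κ Φ t p D g by omega)
  unfold WxQ4
  push_cast
  rw [Int.toNat_of_nonneg (by linarith)]
  linarith

/-- **`KGResY3 … qxYQ4 WxYQ4`** (`19sL + 42 ≤ 40·sL`, `96n ≤ 100n`). [this work] -/
theorem kgResY3_Q4 (κ : Consts) {V : Type} [DecidableEq V] [Countable V] {G : SimpleGraph V} [G.LocallyFinite] (Φ : PlanarSkeletonFrmFrom G) (t : V) (p : unitInterval) (D : Skelφ.StepI.DataNS V) (g : ℕ) (f : ℕ) (hN : EqNumL κ Φ t p D g f) : KGResY3 κ Φ t p D g f (qxYQ4 κ Φ t p D g f) (WxYQ4 κ Φ t p D g f) := by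
  refine ⟨?_, by unfold WxYQ4; omega⟩
  have hsL := ML_sub_one_le_kgSL κ Φ t p D g f hN
  have h960 := slack_floor_le_ML κ Φ t p D g
  have hM : (959 : ℤ) ≤ ML κ Φ t p D g := by exact_mod_cast (show 959 ≤ ML κ Φ t p D g by omega)
  unfold qxYQ4
  rw [kgSLY_eq_kgSL]
  push_cast
  rw [Int.toNat_of_nonneg (by linarith)]
  linarith

/-- `kgqY qxYQ4 = P + 19·sL + 42` as an integer (`P = ⌊nℓ/U⌋ + 1`). [folklore] -/
theorem kgqY_qxYQ4 (κ : Consts) {V : Type} [DecidableEq V] [Countable V] {G : SimpleGraph V} [G.LocallyFinite] (Φ : PlanarSkeletonFrmFrom G) (t : V) (p : unitInterval) (D : Skelφ.StepI.DataNS V) (g : ℕ) (f : ℕ) (hN : EqNumL κ Φ t p D g f) :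
    ((kgqY κ Φ t p D g f (qxYQ4 κ Φ t p D g f) : ℕ) : ℤ) =
      ((nL κ Φ t p D g f * ℓL κ Φ t p D g f / shearUnit (nL κ Φ t p D g f) (hL κ Φ t p D g f) : ℕ) : ℤ) + 1 +
        19 * kgSL (nL κ Φ t p D g f) (ℓL κ Φ t p D g f) (hL κ Φ t p D g f) + 42 := by
  have hsL := ML_sub_one_le_kgSL κ Φ t p D g f hN
  have h960 := slack_floor_le_ML κ Φ t p D g
  have hM : (959 : ℤ) ≤ ML κ Φ t p D g := by exact_mod_cast (show 959 ≤ ML κ Φ t p D g by omega)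
  unfold kgqY qxYQ4
  push_cast
  rw [Int.toNat_of_nonneg (by linarith)]
  ring

/-- `kgWY WxYQ4 = 98·n_L`. [folklore] -/
theorem kgWY_WxYQ4 (κ : Consts) {V : Type} [DecidableEq V] [Countable V] {G : SimpleGraph V} [G.LocallyFinite] (Φ : PlanarSkeletonFrmFrom G) (t : V) (p : unitInterval) (D : Skelφ.StepI.DataNS V) (g : ℕ) (f : ℕ) : ((kgWY κ Φ t p D g f (WxYQ4 κ Φ t p D g f) : ℕ) : ℤ) = 98 * (nL κ Φ t p D g f : ℤ) := by
  unfold kgWY WxYQ4; push_cast; ring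

/-- **`haq` at `small3`**: `aWS small3 ≤ kgq qxQ4 = 98·n_L`. [this work] -/
theorem haq_b3 (κ : Consts) {V : Type} [DecidableEq V] [Countable V] {G : SimpleGraph V} [G.LocallyFinite] (Φ : PlanarSkeletonFrmFrom G) (t : V) (p : unitInterval) (D : Skelφ.StepI.DataNS V) (g : ℕ) (f : ℕ) (hN : EqNumL κ Φ t p D g f) :
    aWS κ Φ t p D g f (BSlot.small3 κ Φ t p D g f) ≤ ((kgq κ Φ t p D g f (qxQ4 κ Φ t p D g f) : ℕ) : ℤ) := by
  have h := aWS_small3_le κ Φ t p D g f hN; unfold kgq qxQ4; push_cast; linarith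

/-- **`hbW` at `small3`**: `bLS small3 ≤ P + kgW WxQ4` (`20sL + 42 ≤ P + sL + 19sL + 42`). [this work] -/
theorem hbW_b3 (κ : Consts) {V : Type} [DecidableEq V] [Countable V] {G : SimpleGraph V} [G.LocallyFinite] (Φ : PlanarSkeletonFrmFrom G) (t : V) (p : unitInterval) (D : Skelφ.StepI.DataNS V) (g : ℕ) (f : ℕ) (hN : EqNumL κ Φ t p D g f) :
    bLS κ Φ t p D g f (BSlot.small3 κ Φ t p D g f) ≤ ((nL κ Φ t p D g f * ℓL κ Φ t p D g f / shearUnit (nL κ Φ t p D g f) (hL κ Φ t p D g f) + 1 +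
      kgW κ Φ t p D g f (WxQ4 κ Φ t p D g f) : ℕ) : ℤ) := by
  have h := bLS_le κ Φ t p D g f (BSlot.small3 κ Φ t p D g f) (by norm_num) hN (small3_row_across κ Φ t p D g f)
  have hsL := ML_sub_one_le_kgSL κ Φ t p D g f hN
  have h960 := slack_floor_le_ML κ Φ t p D g
  have hM : (959 : ℤ) ≤ ML κ Φ t p D g := by
    have : 959 ≤ ML κ Φ t p D g := by omega
    exact_mod_cast this
  have hs0 : 0 ≤ kgSL (nL κ Φ t p D g f) (ℓL κ Φ t p D g f) (hL κ Φ t p D g f) := by linarith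
  unfold kgW WxQ4
  push_cast
  rw [Int.toNat_of_nonneg hs0, Int.toNat_of_nonneg (by linarith)]
  have : (0 : ℤ) ≤ (nL κ Φ t p D g f : ℤ) * (ℓL κ Φ t p D g f : ℤ) / ((shearUnit (nL κ Φ t p D g f) (hL κ Φ t p D g f) : ℕ) : ℤ) :=
    Int.ediv_nonneg (by positivity) (by positivity)
  linarith

/-- **`haWm/haWp` at `small3`**: `aWS small3 ≤ (n_L ± v_L)⁺ + kgWY WxYQ4` (`98·n_L ≤ 0 + 98·n_L`). [this work] -/
theorem haW_b3 (κ : Consts) {V : Type} [DecidableEq V] [Countable V] {G : SimpleGraph V} [G.LocallyFinite] (Φ : PlanarSkeletonFrmFrom G) (t : V) (p : unitInterval) (D : Skelφ.StepI.DataNS V) (g : ℕ) (f : ℕ) (hN : EqNumL κ Φ t p D g f) :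
    aWS κ Φ t p D g f (BSlot.small3 κ Φ t p D g f) ≤ ((((nL κ Φ t p D g f : ℤ) + vL κ Φ t p D g f).toNat + kgWY κ Φ t p D g f (WxYQ4 κ Φ t p D g f) : ℕ) : ℤ) ∧
    aWS κ Φ t p D g f (BSlot.small3 κ Φ t p D g f) ≤ ((((nL κ Φ t p D g f : ℤ) - vL κ Φ t p D g f).toNat + kgWY κ Φ t p D g f (WxYQ4 κ Φ t p D g f) : ℕ) : ℤ) := by
  have h := aWS_small3_le κ Φ t p D g f hN
  have h1 : (0 : ℤ) ≤ ((((nL κ Φ t p D g f : ℤ) + vL κ Φ t p D g f).toNat : ℕ) : ℤ) := by positivity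
  have h2 : (0 : ℤ) ≤ ((((nL κ Φ t p D g f : ℤ) - vL κ Φ t p D g f).toNat : ℕ) : ℤ) := by positivity
  unfold kgWY WxYQ4
  constructor <;> · push_cast; linarith

/-- **`hbq` at `small3`**: `bLS small3 ≤ kgqY qxYQ4 = P + 19·sL + 42` (`bLS small3 ≤ 20sL + 42`, `sL ≤ P − 1`). [this work] -/
theorem hbq_b3 (κ : Consts) {V : Type} [DecidableEq V] [Countable V] {G : SimpleGraph V} [G.LocallyFinite] (Φ : PlanarSkeletonFrmFrom G) (t : V) (p : unitInterval) (D : Skelφ.StepI.DataNS V) (g : ℕ) (f : ℕ) (hN : EqNumL κ Φ t p D g f) :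
    bLS κ Φ t p D g f (BSlot.small3 κ Φ t p D g f) ≤ ((kgqY κ Φ t p D g f (qxYQ4 κ Φ t p D g f) : ℕ) : ℤ) := by
  have h := bLS_le κ Φ t p D g f _ (by norm_num) hN (small3_row_across κ Φ t p D g f)
  have hP := kgSL_le_natDiv κ Φ t p D g f hN
  rw [kgqY_qxYQ4 κ Φ t p D g f hN]
  linarith

end Residuals2

end NegB

end PlanarSkeletonFrmFrom

end Summit.CriticalPhenomena.PercolationContinuityZ3.Theorems.Transplant

end
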